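import Literature.AlgebraicGeometry.ShimuraVarieties.UnitaryShimuraCurveDescendedPieces
import Literature.AlgebraicGeometry.ShimuraVarieties.UnitaryShimuraCanonicalModelComplexFibre
import Literature.NumberTheory.Transcendental.Analytification
import HarnessLib

/-!
# The special curves COVER the descended unitary Shimura curve and are DISJOINT (road (ii), seam of leaf L3.6)

Topic `AlgebraicGeometry/ShimuraVarieties`, namespace `…ShimuraVarieties.UnitaryCanonicalModel`.  THEOREMS ONLY (no
definition, no named fact, no instance, no `sorry`).  Cell `hodgecm-mathlib`, road (ii) «embedded-curve descent» of the
census «GS-3 ⇐ #62» (A-p10 g7 CUT memo `CUT-R2-5-FIELDS`); books 0 — nothing here is a proof of GS-3.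

SETTING (one surface level `K`, one curve level `K⋆` with `φGS(K⋆) ≤ K`; the binder block of ★
`exists_cofan_pieces_of_specialCurves`, token for token).  The SURFACE record `R` with its complex pieces
`(X_q, unif_q, g_q)_q` (a colimit cofan of `(M_K)_τ`); finitely many CLOSED special curves `κ_r : Z_r ↪ X_{q′(r)}` of the
surface pieces uniformised by disc data `B⋆_r` intertwined with the surface pieces along the frames `γ_r B`
(`κ_r(ℂ)(unif⋆_r v) = unif_{q′(r)}((γ_r B)^τ(v ⊕ 0))`, bookkeepers `g_{q′(r)}⁻¹ γ_{r,f} φGS(g⋆_r) ∈ K`) at representatives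
`g⋆_r ∈ U(J⋆)(𝔸_{L⁺,f})` which EXHAUST the classes of `U(J⋆)(L⁺) \ U(J⋆)(𝔸_f) / K⋆` (`hgs`) and are pairwise INEQUIVALENT
(`hgs'`); the embedding `embPoints : Sh_{K⋆}(U(J⋆))(ℂ) → Sh_K(U(H))(ℂ)` INJECTIVE (★ F-INJ); and the Zariski closure
`C(K⋆, K)` of the embedded curve inside `(M_K)_τ` with the property that its complex points ARE embedded points (leaf L3.2,
`himg`).

RESULTS.
* §1 plumbing over a Jacobson space / a `ℂ`-scheme locally of finite type: closed subsets are compared on CLOSED points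
  (Mathlib `JacobsonSpace.closure_inter_closedPoints_eq_closure`, `nonempty_inter_closedPoints`), closed points are complex
  points (★ `ComplexPoints.equivClosedPoints`).
* §2 `RecordSystem.pt_mem_range_specialCurve_iff` — **the complex points of the image `κ_r(Z_r) ⊆ (M_K)_τ` are exactly
  the embedded points `pts_K⁻¹(embPoints [v, g⋆_r K⋆])`, `v` negative** (`surjOn_unif` of the disc datum, the intertwining
  `hf`, ★ `map_piece_unif_frameEmbNeg_eq_embPoints`).
* §3 `RecordSystem.iUnion_range_specialCurve_eq_closure` — **the special curves COVER the closure of the embedded curve**: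
  `⋃_r κ_r(Z_r) = C(K⋆, K)`; `RecordSystem.pairwise_disjoint_range_specialCurve` — **and are pairwise DISJOINT** (a common
  point has a common closed point in its closure; closed points are embedded points; `embPoints` is injective; inequivalent
  representatives); `RecordSystem.pairwise_disjoint_and_iUnion_range_eq_of_specialCurves` — both conclusions in the exact
  spelling of the binders `hdisj`/`hcov` of ★ `exists_cofan_pieces_of_specialCurves`, the cover read against the descended
  level `j : M⋆ ↪ M_K` through ★ `RecordSystem.exists_descendedTower`'s `hrange` clause.
* §4 `CosetSpace.exists_inv_mul_rep_mem_of_mk_pt_eq` / `CosetSpace.eq_of_inv_mul_rep_mem_of_mk_pt_eq` — the two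
  representative clauses `hgs`/`hgs'` FROM a section `g` of the double-coset projection (`⟦g_q K⟧ = q`), generic.

NOT here: the lifted cofan itself (★ `exists_cofan_pieces_of_specialCurves`), the special curves and their reindexing
(leaf L3.3), `himg` (leaf L3.2), injectivity of `embPoints` (★ F-INJ), the head GS-3″ (L3.7).

## References
* [Deligne1979ShimuraVarieties] P. Deligne, *Variétés de Shimura* (1979), 2.1.2–2.1.4 (`Sh_K(ℂ)` is the disjoint sum of the `Γ_g∖X⁺`).
* [Milne2005ShimuraVarieties] J. S. Milne, *Introduction to Shimura varieties* (2005/2017), Lemma 5.13 p. 57, Thm. 5.16 p. 59, Thm. 13.6 p. 118.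
* [Liu2021] Y. Liu, Camb. J. Math. 9 (2021), proof of Thm. 4.15 (FJcycle.tex l. 2193–2208).
* [GortzWedhorn2020] U. Görtz, T. Wedhorn, *Algebraic Geometry I* (2nd ed. 2020), Prop. 3.35 (very dense closed points), §(3.5) Prop. 3.10.
* [MumfordRedBook1999] D. Mumford, *The Red Book of Varieties and Schemes*, I §10 (closed points = complex points).
-/

set_option autoImplicit false

noncomputable section

open Function MulAction Topology NumberField IsDedekindDomain CategoryTheory CategoryTheory.Limits Matrix AlgebraicGeometry Set
open scoped Matrix ComplexOrder
open Literature.AlgebraicGeometry.Motives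
open Literature.AlgebraicGeometry.Morphisms (isColimit_cofan_left isClopen_range_of_isColimit_cofan isOpenImmersion_of_isColimit_cofan)
open Literature.NumberTheory.Automorphic Literature.NumberTheory.Automorphic.UnitaryGroup
open Literature.NumberTheory.Automorphic.ShimuraDissection
open Literature.NumberTheory.Automorphic.Liu2021.AppendixC (C5.OpenCompactSubgroup C5.SmallLevel)
open Literature.Geometry.ComplexHyperbolic Literature.Geometry.ComplexHyperbolic.BallModel

/-! ### §4 (stated first, generic). Representative clauses from a section of the double-coset projection -/

namespace Literature.NumberTheory.Automorphic.ShimuraDissection.CosetSpace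

variable {Γ : Type*} {A : Type*} [Group Γ] [Group A] (ι : Γ →* A) (K : Subgroup A)

/-- **Representatives exhaust the classes**: for a section `g` of `A → Γ \ (A ⧸ K)` (`⟦g_q K⟧ = q`) and an index family
`gs = g ∘ e` along ANY surjection `e` onto the double-coset space, every `a ∈ A` satisfies `(ι(δ) a)⁻¹ gs_r ∈ K` for some
index `r` and some `δ ∈ Γ` — ★ `CosetSpace.exists_smul_rep_mem` re-indexed. [cite: Milne2005ShimuraVarieties, Lemma 5.13 p. 57] -/
theorem exists_inv_mul_rep_mem_of_mk_pt_eq {g : orbitRel.Quotient Γ (CosetSpace ι K) → A}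
    (hg : ∀ q, Quotient.mk'' (pt ι K (g q)) = q) (a : A) :
    ∃ (q : orbitRel.Quotient Γ (CosetSpace ι K)) (δ : Γ), (ι δ * a)⁻¹ * g q ∈ K :=
  let ⟨δ, hδ⟩ := exists_smul_rep_mem ι K hg a
  ⟨_, δ, hδ⟩

/-- **Representatives of distinct classes are inequivalent**: for a section `g` of the double-coset projection
(`⟦g_q K⟧ = q`), `(ι(δ) g_{q′})⁻¹ g_q ∈ K` forces `q = q′`. [cite: Milne2005ShimuraVarieties, Lemma 5.13 p. 57] -/
theorem eq_of_inv_mul_rep_mem_of_mk_pt_eq {g : orbitRel.Quotient Γ (CosetSpace ι K) → A}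
    (hg : ∀ q, Quotient.mk'' (pt ι K (g q)) = q) (q q' : orbitRel.Quotient Γ (CosetSpace ι K)) (δ : Γ)
    (h : (ι δ * g q')⁻¹ * g q ∈ K) : q = q' := by
  rw [← hg q, ← hg q', Quotient.eq'']
  refine MulAction.orbitRel_apply.mpr (MulAction.mem_orbit_iff.mpr ⟨δ, ?_⟩)
  rw [smul_pt, pt_eq_pt_iff]
  exact h

end Literature.NumberTheory.Automorphic.ShimuraDissection.CosetSpace

namespace Literature.AlgebraicGeometry.ShimuraVarieties.UnitaryCanonicalModel

/-! ### §1. Plumbing: closed sets of a Jacobson space are compared on closed points; closed points of a `ℂ`-scheme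
locally of finite type are complex points -/

section Plumbing

/-- In a Jacobson space two CLOSED sets `C ⊆ C′` as soon as every closed point of `C` lies in `C′`
(`C = closure (C ∩ closedPoints)`). [cite: GortzWedhorn2020, Prop. 3.35] -/
private theorem subset_of_forall_mem_closedPoints {α : Type*} [TopologicalSpace α] [JacobsonSpace α] {C C' : Set α}
    (hC : IsClosed C) (hC' : IsClosed C') (h : ∀ x ∈ closedPoints α, x ∈ C → x ∈ C') : C ⊆ C' := by
  rw [← hC.closure_eq, ← JacobsonSpace.closure_inter_closedPoints_eq_closure hC.isLocallyClosed, hC'.closure_subset_iff]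
  exact fun x hx => h x hx.2 hx.1

/-- In a Jacobson space two CLOSED sets without a common closed point are disjoint (a common point has a closed point in
the closure of its singleton, Mathlib `nonempty_inter_closedPoints`). [cite: GortzWedhorn2020, Prop. 3.35] -/
private theorem disjoint_of_forall_mem_closedPoints {α : Type*} [TopologicalSpace α] [JacobsonSpace α] {C C' : Set α}
    (hC : IsClosed C) (hC' : IsClosed C') (h : ∀ x ∈ closedPoints α, x ∈ C → x ∈ C' → False) : Disjoint C C' := by
  refine Set.disjoint_left.mpr fun x hx hx' => ?_
  obtain ⟨y, ⟨hyC, hyC'⟩, hy⟩ := nonempty_inter_closedPoints (Z := C ∩ C') ⟨x, hx, hx'⟩ (hC.inter hC').isLocallyClosed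
  exact h y hy hyC hyC'

/-- A closed point of a `ℂ`-scheme locally of finite type underlies a complex point (Nullstellensatz, ★
`ComplexPoints.equivClosedPoints`). [cite: MumfordRedBook1999, I §10] -/
private theorem exists_complexPoint_pt_eq {W : SchemeOver ℂ} [LocallyOfFiniteType W.hom] {x : ↥W.left}
    (hx : IsClosed ({x} : Set ↥W.left)) : ∃ Q : ComplexPoints W, Q.pt = x :=
  ⟨(ComplexPoints.equivClosedPoints W).symm ⟨x, hx⟩, by
    rw [← ComplexPoints.coe_equivClosedPoints_apply, Equiv.apply_symm_apply]⟩

/-- Complex points of a `ℂ`-scheme locally of finite type with the same underlying point are equal (★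
`ComplexPoints.equivClosedPoints`). [cite: MumfordRedBook1999, I §10] -/
private theorem complexPoints_pt_injective {W : SchemeOver ℂ} [LocallyOfFiniteType W.hom] :
    Function.Injective fun Q : ComplexPoints W => Q.pt := by
  intro P Q h
  apply (ComplexPoints.equivClosedPoints W).injective
  exact Subtype.ext (by rw [ComplexPoints.coe_equivClosedPoints_apply, ComplexPoints.coe_equivClosedPoints_apply]; exact h)

/-- The legs of a colimit cofan of `ℂ`-schemes are closed immersions (open immersions with closed image) — in-file twin of the
private lemma of ★ `UnitaryShimuraCurveDescendedPieces`. [cite: GortzWedhorn2020, §(3.5) Prop. 3.10 and Example 3.11] -/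
private theorem isClosedImmersion_leg_of_isColimit' {Ξ : Type} {X : Ξ → SchemeOver ℂ} {S : SchemeOver ℂ}
    {ι : ∀ q, X q ⟶ S} (hcol : IsColimit (Cofan.mk S ι)) (q : Ξ) : IsClosedImmersion (ι q).left := by
  obtain ⟨hcl⟩ := isColimit_cofan_left hcol
  haveI : IsOpenImmersion (ι q).left := isOpenImmersion_of_isColimit_cofan hcl q
  exact IsClosedImmersion.of_isPreimmersion _ (isClopen_range_of_isColimit_cofan hcl q).1

/-- A smooth `ℂ`-scheme (of some relative dimension) is locally of finite type, hence its underlying space is Jacobson.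
[cite: GortzWedhorn2020, Prop. 3.35] -/
private theorem jacobsonSpace_of_smoothOfRelativeDimension (n : ℕ) (W : SchemeOver ℂ) [SmoothOfRelativeDimension n W.hom] :
    JacobsonSpace ↥W.left :=
  haveI : Smooth W.hom := SmoothOfRelativeDimension.smooth n W.hom
  LocallyOfFiniteType.jacobsonSpace W.hom

end Plumbing

/-! ### §2. The complex points of the image of a special curve are the embedded points at its representative -/

section Seam

variable {L : Type} [Field L] [NumberField L] [IsCMField L] {Jstar : Matrix (Fin 2) (Fin 2) L} {τ : L →+* ℂ}
  {K₀ : C5.OpenCompactSubgroup ↥(finAdelic (↥(maximalRealSubfield L)) L (IsCMField.complexConj L) 2 Jstar)}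
  {H : Matrix (Fin 3) (Fin 3) L} {T : GL (Fin 3) ℂ} {hT : formCongr (starRingEnd ℂ) T (H.map τ) = BallModel.J}
  {K₀' : C5.OpenCompactSubgroup ↥(finAdelic (↥(maximalRealSubfield L)) L (IsCMField.complexConj L) 3 H)}
  (R : RecordSystem L H τ T hT K₀')
  (Jperp : Matrix (Fin 1) (Fin 1) L) (B : GL (Fin 3) L) {a : L} (ha : a ≠ 0)
  (hB : formCongr ((IsCMField.complexConj L : L ≃ₐ[↥(maximalRealSubfield L)] L) : L →+* L) B (a • H) = finSum 2 1 Jstar Jperp)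
  (hτa : 0 < (τ a).re) (hτa' : (τ a).im = 0)
  {Kstar : C5.SmallLevel K₀} {K : C5.SmallLevel K₀'} (hK : Kstar.1.1.map (φGS L Jstar Jperp H B ha hB) ≤ K.1.1)
  -- the surface pieces at level `K` (the binders of ★ `exists_cofan_pieces_of_specialCurves`, token for token)
  {Ξ : Type} {X : Ξ → SchemeOver ℂ} (ι : ∀ q, X q ⟶ (Motives.baseChangeHom τ).obj (R.M.obj K))
  (hcol : IsColimit (Cofan.mk ((Motives.baseChangeHom τ).obj (R.M.obj K)) ι))
  (Bq : ∀ q, UnitaryBallUniformisationDatum 2 (X q))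
  (gq : Ξ → finAdelic (↥(maximalRealSubfield L)) L (IsCMField.complexConj L) 3 H)
  (hBq : ∀ q, (Bq q).Hℂ = H.map τ)
  (hιq : letI : Algebra L ℂ := τ.toAlgebra
    ∀ q (x : Ball), AlgPoints.map (L := ℂ) (ι q) ((Bq q).unif ((T : Matrix (Fin 3) (Fin 3) ℂ) *ᵥ BallModel.lift x)) =
      AlgPoints.baseChangeEquiv τ (R.M.obj K) ((R.pts K).symm (ShimuraSet.mk L H τ T hT K.1.1 x (gq q))))
  -- the special curves of the surface pieces, with their disc data and bookkeepers
  {Ξs : Type} (gs : Ξs → ↥(finAdelic (↥(maximalRealSubfield L)) L (IsCMField.complexConj L) 2 Jstar))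
  (q' : Ξs → Ξ) (γ : Ξs → ↥(rational (↥(maximalRealSubfield L)) L (IsCMField.complexConj L) 3 H))
  (hγ : ∀ r, (gq (q' r))⁻¹ * (rationalToFinAdelic (↥(maximalRealSubfield L)) L (IsCMField.complexConj L) 3 H (γ r) *
    φGS L Jstar Jperp H B ha hB (gs r)) ∈ K.1.1)
  {Z : Ξs → SchemeOver ℂ} (κ : ∀ r, Z r ⟶ X (q' r)) [∀ r, IsClosedImmersion (κ r).left]
  (Bs : ∀ r, UnitaryBallUniformisationDatum 1 (Z r)) (hBs : ∀ r, (Bs r).Hℂ = Jstar.map τ)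
  (hf : ∀ r, ∀ v ∈ negCone (Jstar.map τ),
    AlgPoints.map (κ r) ((Bs r).unif v) = (Bq (q' r)).unif (frameEmbNeg τ ((γ r : GL (Fin 3) L) * B) v))

include hcol in
/-- The image `κ_r(Z_r) ⊆ (M_K)_τ` of a special curve under the piece inclusion is Zariski CLOSED (the cofan legs are closed
immersions). [cite: GortzWedhorn2020, §(3.5) Prop. 3.10] -/
theorem RecordSystem.isClosed_range_specialCurve (r : Ξs) : IsClosed (Set.range ⇑(κ r ≫ ι (q' r)).left) := by
  haveI : IsClosedImmersion (ι (q' r)).left := isClosedImmersion_leg_of_isColimit' hcol (q' r)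
  haveI : IsClosedImmersion (κ r ≫ ι (q' r)).left := by rw [Over.comp_left]; infer_instance
  exact (κ r ≫ ι (q' r)).left.isClosedEmbedding.isClosed_range

include hcol hBq hBs hf hιq hγ hτa hτa' in
/-- **The complex points of the image of a special curve are the embedded points at its representative**: for a complex point
`Q` of `(M_K)_τ`, `Q ∈ κ_r(Z_r)` iff `Q = pts_K⁻¹(embPoints [v, g⋆_r K⋆])` for a negative `v` — every complex point of `Z_r`
is `unif⋆_r v` (`surjOn_unif`), `κ_r(unif⋆_r v) = unif_{q′(r)}((γ_r B)^τ(v ⊕ 0))` (`hf`) and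
`ι_{q′(r)}(unif_{q′(r)}((γ_r B)^τ(v ⊕ 0))) = pts_K⁻¹(embPoints [v, g⋆_r K⋆])` (★ `map_piece_unif_frameEmbNeg_eq_embPoints`); closed
points of `Z_r` and of `(M_K)_τ` are complex points (Nullstellensatz). [cite: Milne2005ShimuraVarieties, Lemma 5.13 p. 57 and Thm. 5.16 p. 59]
[cite: Deligne1979ShimuraVarieties, 2.1.2] [cite: MumfordRedBook1999, I §10] -/
theorem RecordSystem.pt_mem_range_specialCurve_iff (r : Ξs)
    (Q : ComplexPoints ((Motives.baseChangeHom τ).obj (R.M.obj K))) :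
    letI : Algebra L ℂ := τ.toAlgebra
    Q.pt ∈ Set.range ⇑(κ r ≫ ι (q' r)).left ↔
      ∃ (v : Fin 2 → ℂ) (hv : v ∈ negCone (Jstar.map τ)),
        Q = AlgPoints.baseChangeEquiv τ (R.M.obj K) ((R.pts K).symm
          (ShimuraSetGS.embPoints L H τ T hT Jstar Jperp B ha hB hτa hτa' Kstar.1.1 K.1.1 hK
            (ShimuraSetGS.mk L Jstar τ Kstar.1.1 v hv (gs r)))) := by
  letI : Algebra L ℂ := τ.toAlgebra
  haveI : IsClosedImmersion (ι (q' r)).left := isClosedImmersion_leg_of_isColimit' hcol (q' r)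
  haveI : IsClosedImmersion (κ r ≫ ι (q' r)).left := by rw [Over.comp_left]; infer_instance
  haveI : LocallyOfFiniteType (Z r).hom := by
    haveI := (Bs r).isSmoothProjective.smoothOfRelativeDimension
    haveI : Smooth (Z r).hom := SmoothOfRelativeDimension.smooth 1 (Z r).hom
    infer_instance
  haveI : LocallyOfFiniteType ((Motives.baseChangeHom τ).obj (R.M.obj K)).hom := by
    haveI := R.smooth_complexFibre K
    haveI : Smooth ((Motives.baseChangeHom τ).obj (R.M.obj K)).hom :=
      SmoothOfRelativeDimension.smooth 2 ((Motives.baseChangeHom τ).obj (R.M.obj K)).hom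
    infer_instance
  -- the common computation: `(κ_r ≫ ι_{q′ r})(unif⋆_r v) = pts_K⁻¹(embPoints [v, g⋆_r K⋆])` on complex points
  have key : ∀ (v : Fin 2 → ℂ) (hv : v ∈ negCone (Jstar.map τ)),
      AlgPoints.map (κ r ≫ ι (q' r)) ((Bs r).unif v) =
        AlgPoints.baseChangeEquiv τ (R.M.obj K) ((R.pts K).symm
          (ShimuraSetGS.embPoints L H τ T hT Jstar Jperp B ha hB hτa hτa' Kstar.1.1 K.1.1 hK
            (ShimuraSetGS.mk L Jstar τ Kstar.1.1 v hv (gs r)))) := fun v hv => by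
    rw [AlgPoints.map_comp_apply, hf r v hv,
      map_piece_unif_frameEmbNeg_eq_embPoints R Jperp B ha hB hτa hτa' hK (Bq (q' r)) (gq (q' r)) (gs r) (γ r)
        (hBq (q' r)) (ι (q' r)) (hιq (q' r)) (hγ r) v hv]
  constructor
  · rintro ⟨z, hz⟩
    -- `z` is a closed point of `Z_r` (its image `Q.pt` is closed and `κ_r ≫ ι` is a closed embedding), hence a complex point
    have hzc : IsClosed ({z} : Set ↥(Z r).left) := by
      rw [← mem_closedPoints_iff, ← (κ r ≫ ι (q' r)).left.isClosedEmbedding.preimage_closedPoints, Set.mem_preimage,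
        mem_closedPoints_iff]
      convert Q.isClosed_pt using 2
    obtain ⟨P, hP⟩ := exists_complexPoint_pt_eq hzc
    -- `P = unif⋆_r v` with `v` negative for `J⋆^τ`
    obtain ⟨v, hv, hPv⟩ := (Bs r).surjOn_unif (Set.mem_univ P)
    have hv' : v ∈ negCone (Jstar.map τ) := by
      have h : v ∈ negCone (Bs r).Hℂ := hv
      rwa [hBs r] at h
    refine ⟨v, hv', complexPoints_pt_injective ?_⟩
    change Q.pt = (AlgPoints.baseChangeEquiv τ (R.M.obj K) ((R.pts K).symm
      (ShimuraSetGS.embPoints L H τ T hT Jstar Jperp B ha hB hτa hτa' Kstar.1.1 K.1.1 hK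
        (ShimuraSetGS.mk L Jstar τ Kstar.1.1 v hv' (gs r))))).pt
    rw [← key v hv', AlgPoints.pt_map, hPv, hP]
    exact hz.symm
  · rintro ⟨v, hv, rfl⟩
    rw [← key v hv, AlgPoints.pt_map]
    exact ⟨_, rfl⟩

/-! ### §3. The special curves cover the closure of the embedded curve and are pairwise disjoint -/

include hcol hBq hBs hf hιq hγ in
/-- **The special curves COVER the Zariski closure of the embedded curve**: `⋃_r κ_r(Z_r) = C(K⋆, K)`, the closure of
`{pts_K⁻¹(embPoints P) : P ∈ Sh_{K⋆}(U(J⋆))(ℂ)}` in `(M_K)_τ` — `⊇`: every class is `[v, uK⋆] = [δ^τ v, g⋆_r K⋆]` at a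
representative (`hgs`, ★ `ShimuraSetGS.mk_eq_mk_mulVec_rep`), so the embedded points lie in the finite union of the CLOSED
sets `κ_r(Z_r)`; `⊆`: closed sets of the Jacobson space `(M_K)_τ` are compared on closed points, which are complex points, and
the complex points of `κ_r(Z_r)` are embedded points (§2). [cite: Deligne1979ShimuraVarieties, 2.1.2]
[cite: Milne2005ShimuraVarieties, Lemma 5.13 p. 57 and Thm. 5.16 p. 59] [cite: GortzWedhorn2020, Prop. 3.35] -/
theorem RecordSystem.iUnion_range_specialCurve_eq_closure [Finite Ξs]
    (hgs : ∀ u : ↥(finAdelic (↥(maximalRealSubfield L)) L (IsCMField.complexConj L) 2 Jstar),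
      ∃ (r : Ξs) (δ : ↥(rational (↥(maximalRealSubfield L)) L (IsCMField.complexConj L) 2 Jstar)),
        (rationalToFinAdelic (↥(maximalRealSubfield L)) L (IsCMField.complexConj L) 2 Jstar δ * u)⁻¹ * gs r ∈ Kstar.1.1) :
    letI : Algebra L ℂ := τ.toAlgebra
    ⋃ r, Set.range ⇑(κ r ≫ ι (q' r)).left =
      closure (AlgPoints.pt '' Set.range fun P : ShimuraSetGS L Jstar τ Kstar.1.1 =>
        AlgPoints.baseChangeEquiv τ (R.M.obj K) ((R.pts K).symm
          (ShimuraSetGS.embPoints L H τ T hT Jstar Jperp B ha hB hτa hτa' Kstar.1.1 K.1.1 hK P))) := by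
  letI : Algebra L ℂ := τ.toAlgebra
  have hclosed : ∀ r, IsClosed (Set.range ⇑(κ r ≫ ι (q' r)).left) := fun r =>
    R.isClosed_range_specialCurve ι hcol q' κ r
  have hU : IsClosed (⋃ r, Set.range ⇑(κ r ≫ ι (q' r)).left) := isClosed_iUnion_of_finite hclosed
  haveI : JacobsonSpace ↥((Motives.baseChangeHom τ).obj (R.M.obj K)).left :=
    haveI := R.smooth_complexFibre K
    jacobsonSpace_of_smoothOfRelativeDimension 2 _
  haveI : LocallyOfFiniteType ((Motives.baseChangeHom τ).obj (R.M.obj K)).hom := by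
    haveI := R.smooth_complexFibre K
    haveI : Smooth ((Motives.baseChangeHom τ).obj (R.M.obj K)).hom :=
      SmoothOfRelativeDimension.smooth 2 ((Motives.baseChangeHom τ).obj (R.M.obj K)).hom
    infer_instance
  apply subset_antisymm
  · -- `⊆`: on closed points, which are complex points, which are embedded points
    refine subset_of_forall_mem_closedPoints hU isClosed_closure fun x hx hxU => ?_
    obtain ⟨Q, rfl⟩ := exists_complexPoint_pt_eq (mem_closedPoints_iff.mp hx)
    obtain ⟨r, hr⟩ := Set.mem_iUnion.mp hxU
    obtain ⟨v, hv, rfl⟩ :=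
      (R.pt_mem_range_specialCurve_iff Jperp B ha hB hτa hτa' hK ι hcol Bq gq hBq hιq gs q' γ hγ κ Bs hBs hf r Q).mp hr
    exact subset_closure ⟨_, ⟨_, rfl⟩, rfl⟩
  · -- `⊇`: the embedded points lie in the (closed) union — move to a representative
    refine hU.closure_subset_iff.mpr ?_
    rintro _ ⟨_, ⟨P, rfl⟩, rfl⟩
    obtain ⟨v, hv, u, rfl⟩ := ShimuraSetGS.mk_surjective L Jstar τ Kstar.1.1 P
    obtain ⟨r, δ, hδ⟩ := hgs u
    have hx : ((ratToGLℂ L Jstar τ δ : GL (Fin 2) ℂ) : Matrix (Fin 2) (Fin 2) ℂ) *ᵥ v ∈ negCone (Jstar.map τ) := by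
      have h := smul_ratToGLℂ_mulVec_mem_negCone (L := L) (Jstar := Jstar) (τ := τ) δ one_ne_zero hv
      rwa [one_smul] at h
    rw [ShimuraSetGS.mk_eq_mk_mulVec_rep v hv u (gs r) δ hδ hx]
    exact Set.mem_iUnion.mpr ⟨r,
      (R.pt_mem_range_specialCurve_iff Jperp B ha hB hτa hτa' hK ι hcol Bq gq hBq hιq gs q' γ hγ κ Bs hBs hf r _).mpr
        ⟨_, hx, rfl⟩⟩

include hcol hBq hBs hf hιq hγ in
/-- **The special curves at inequivalent representatives are pairwise DISJOINT in `(M_K)_τ`** when `embPoints` is injective: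
a common point of the closed sets `κ_r(Z_r)`, `κ_{r′}(Z_{r′})` has a common CLOSED point in the closure of its singleton
(Jacobson), which is a complex point, which is `pts_K⁻¹(embPoints [v, g⋆_r K⋆]) = pts_K⁻¹(embPoints [v′, g⋆_{r′} K⋆])` (§2);
so `[v, g⋆_r K⋆] = [v′, g⋆_{r′} K⋆]` (`hinj`), i.e. `γ g⋆_{r′} K⋆ = g⋆_r K⋆` for a rational `γ` (★ `ShimuraSetGS.mk_eq_mk_iff`),
and `r = r′` (`hgs'`). [cite: Deligne1979ShimuraVarieties, 2.1.2] [cite: Milne2005ShimuraVarieties, Lemma 5.13 p. 57]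
[cite: GortzWedhorn2020, Prop. 3.35] -/
theorem RecordSystem.pairwise_disjoint_range_specialCurve
    (hgs' : ∀ (r r' : Ξs) (δ : ↥(rational (↥(maximalRealSubfield L)) L (IsCMField.complexConj L) 2 Jstar)),
      (rationalToFinAdelic (↥(maximalRealSubfield L)) L (IsCMField.complexConj L) 2 Jstar δ * gs r')⁻¹ * gs r ∈ Kstar.1.1 →
        r = r')
    (hinj : Function.Injective (ShimuraSetGS.embPoints L H τ T hT Jstar Jperp B ha hB hτa hτa' Kstar.1.1 K.1.1 hK)) :
    Pairwise (Disjoint on fun r => Set.range ⇑(κ r ≫ ι (q' r)).left) := by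
  letI : Algebra L ℂ := τ.toAlgebra
  have hclosed : ∀ r, IsClosed (Set.range ⇑(κ r ≫ ι (q' r)).left) := fun r =>
    R.isClosed_range_specialCurve ι hcol q' κ r
  haveI : JacobsonSpace ↥((Motives.baseChangeHom τ).obj (R.M.obj K)).left :=
    haveI := R.smooth_complexFibre K
    jacobsonSpace_of_smoothOfRelativeDimension 2 _
  haveI : LocallyOfFiniteType ((Motives.baseChangeHom τ).obj (R.M.obj K)).hom := by
    haveI := R.smooth_complexFibre K
    haveI : Smooth ((Motives.baseChangeHom τ).obj (R.M.obj K)).hom :=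
      SmoothOfRelativeDimension.smooth 2 ((Motives.baseChangeHom τ).obj (R.M.obj K)).hom
    infer_instance
  intro r r' hne
  refine disjoint_of_forall_mem_closedPoints (hclosed r) (hclosed r') fun x hx hxr hxr' => hne ?_
  obtain ⟨Q, rfl⟩ := exists_complexPoint_pt_eq (mem_closedPoints_iff.mp hx)
  obtain ⟨v, hv, hQ⟩ :=
    (R.pt_mem_range_specialCurve_iff Jperp B ha hB hτa hτa' hK ι hcol Bq gq hBq hιq gs q' γ hγ κ Bs hBs hf r Q).mp hxr
  obtain ⟨v', hv', hQ'⟩ :=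
    (R.pt_mem_range_specialCurve_iff Jperp B ha hB hτa hτa' hK ι hcol Bq gq hBq hιq gs q' γ hγ κ Bs hBs hf r' Q).mp hxr'
  rw [hQ] at hQ'
  have h := hinj ((R.pts K).symm.injective ((AlgPoints.baseChangeEquiv τ (R.M.obj K)).injective hQ'))
  obtain ⟨γ', -, -, -, h2⟩ := (ShimuraSetGS.mk_eq_mk_iff L Jstar τ Kstar.1.1 v v' hv hv' (gs r) (gs r')).mp h
  have h3 := Kstar.1.1.inv_mem (QuotientGroup.eq.mp h2.symm)
  rw [_root_.mul_inv_rev, inv_inv] at h3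
  exact hgs' r r' γ' h3

include hcol hBq hBs hf hιq hγ in
/-- **L3.6-SEAM — the two set-theoretic binders `hdisj`/`hcov` of ★ `exists_cofan_pieces_of_specialCurves`, discharged.**
For the descended level `j : M⋆ ↪ M_K` over `L` with `|j ⊗_{L,τ} ℂ| = C(K⋆, K)` (the `hrange` clause of ★
`RecordSystem.exists_descendedTower`, its spelling verbatim), special curves at representatives `g⋆_r` exhausting the classes
(`hgs`) and pairwise inequivalent (`hgs'`), and `embPoints` injective (★ F-INJ): the images `κ_r(Z_r) ⊆ (M_K)_τ` are pairwise
disjoint and their union is the image of `(M⋆)_τ`. [cite: Deligne1979ShimuraVarieties, 2.1.2–2.1.4]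
[cite: Milne2005ShimuraVarieties, Lemma 5.13 p. 57, Thm. 5.16 p. 59, Thm. 13.6 p. 118] -/
theorem RecordSystem.pairwise_disjoint_and_iUnion_range_eq_of_specialCurves [Finite Ξs]
    (hgs : ∀ u : ↥(finAdelic (↥(maximalRealSubfield L)) L (IsCMField.complexConj L) 2 Jstar),
      ∃ (r : Ξs) (δ : ↥(rational (↥(maximalRealSubfield L)) L (IsCMField.complexConj L) 2 Jstar)),
        (rationalToFinAdelic (↥(maximalRealSubfield L)) L (IsCMField.complexConj L) 2 Jstar δ * u)⁻¹ * gs r ∈ Kstar.1.1)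
    (hgs' : ∀ (r r' : Ξs) (δ : ↥(rational (↥(maximalRealSubfield L)) L (IsCMField.complexConj L) 2 Jstar)),
      (rationalToFinAdelic (↥(maximalRealSubfield L)) L (IsCMField.complexConj L) 2 Jstar δ * gs r')⁻¹ * gs r ∈ Kstar.1.1 →
        r = r')
    {Mst : SchemeOver L} (j : Mst ⟶ R.M.obj K)
    (hrangeZ : letI : Algebra L ℂ := τ.toAlgebra
      Set.range ⇑((AbelianVariety.bcFunctor L ℂ).map j).left =
        closure (AlgPoints.pt '' Set.range fun P : ShimuraSetGS L Jstar τ Kstar.1.1 =>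
          AlgPoints.baseChangeEquiv τ (R.M.obj K) ((R.pts K).symm
            (ShimuraSetGS.embPoints L H τ T hT Jstar Jperp B ha hB hτa hτa' Kstar.1.1 K.1.1 hK P))))
    (hinj : Function.Injective (ShimuraSetGS.embPoints L H τ T hT Jstar Jperp B ha hB hτa hτa' Kstar.1.1 K.1.1 hK)) :
    Pairwise (Disjoint on fun r => Set.range ⇑(κ r ≫ ι (q' r)).left) ∧
      ⋃ r, Set.range ⇑(κ r ≫ ι (q' r)).left = Set.range ⇑((Motives.baseChangeHom τ).map j).left := by
  letI : Algebra L ℂ := τ.toAlgebra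
  refine ⟨R.pairwise_disjoint_range_specialCurve Jperp B ha hB hτa hτa' hK ι hcol Bq gq hBq hιq gs q' γ hγ κ Bs hBs hf
    hgs' hinj, ?_⟩
  rw [R.iUnion_range_specialCurve_eq_closure Jperp B ha hB hτa hτa' hK ι hcol Bq gq hBq hιq gs q' γ hγ κ Bs hBs hf hgs]
  exact hrangeZ.symm

include hcol hBq hBs hf hιq hγ in
/-- **The complex points of the closure `C(K⋆, K)` are embedded points** — the shape of leaf L3.2 (`himg`) as a COROLLARY
of the special-curve data: a complex point of the closure lies in some `κ_r(Z_r)` (§3) and is therefore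
`pts_K⁻¹(embPoints [v, g⋆_r K⋆])` (§2). [cite: Milne2005ShimuraVarieties, Thm. 5.16 p. 59 and Lemma 5.13 p. 57]
[cite: Deligne1979ShimuraVarieties, 2.1.2] -/
theorem RecordSystem.mem_range_emb_of_pt_mem_closure_of_specialCurves [Finite Ξs]
    (hgs : ∀ u : ↥(finAdelic (↥(maximalRealSubfield L)) L (IsCMField.complexConj L) 2 Jstar),
      ∃ (r : Ξs) (δ : ↥(rational (↥(maximalRealSubfield L)) L (IsCMField.complexConj L) 2 Jstar)),
        (rationalToFinAdelic (↥(maximalRealSubfield L)) L (IsCMField.complexConj L) 2 Jstar δ * u)⁻¹ * gs r ∈ Kstar.1.1)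
    (Q : ComplexPoints ((Motives.baseChangeHom τ).obj (R.M.obj K)))
    (hQ : letI : Algebra L ℂ := τ.toAlgebra
      Q.pt ∈ closure (AlgPoints.pt '' Set.range fun P : ShimuraSetGS L Jstar τ Kstar.1.1 =>
        AlgPoints.baseChangeEquiv τ (R.M.obj K) ((R.pts K).symm
          (ShimuraSetGS.embPoints L H τ T hT Jstar Jperp B ha hB hτa hτa' Kstar.1.1 K.1.1 hK P)))) :
    letI : Algebra L ℂ := τ.toAlgebra
    Q ∈ Set.range fun P : ShimuraSetGS L Jstar τ Kstar.1.1 =>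
      AlgPoints.baseChangeEquiv τ (R.M.obj K) ((R.pts K).symm
        (ShimuraSetGS.embPoints L H τ T hT Jstar Jperp B ha hB hτa hτa' Kstar.1.1 K.1.1 hK P)) := by
  letI : Algebra L ℂ := τ.toAlgebra
  rw [← R.iUnion_range_specialCurve_eq_closure Jperp B ha hB hτa hτa' hK ι hcol Bq gq hBq hιq gs q' γ hγ κ Bs hBs hf hgs,
    Set.mem_iUnion] at hQ
  obtain ⟨r, hr⟩ := hQ
  obtain ⟨v, hv, rfl⟩ :=
    (R.pt_mem_range_specialCurve_iff Jperp B ha hB hτa hτa' hK ι hcol Bq gq hBq hιq gs q' γ hγ κ Bs hBs hf r Q).mp hr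
  exact ⟨_, rfl⟩

end Seam

end Literature.AlgebraicGeometry.ShimuraVarieties.UnitaryCanonicalModel

end
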